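/-
Copyright (c) 2026 the pub-hodgecm-mathlib formalisation cell (harness21).  Prover seat hodgecm-mathlib-K2E4-p10 (g7), Track B ∕ K2-LIT, h413 = `stmt-HodgeConjecture-24833`,
line `K2_E1_TraceFormulaBeta`, 5Res ROADCARD AMENDMENT #3 «GENERAL (U,τ) LADDER» rung G0 (dealer K2E1-plan (g7) (266)∕(268)): the COFINALITY GLUE — the atoms of ★ p860390
`levelFinite_of_atoms` need only be paid on a COFINAL family of levels `U` (all `K_∞`-characters), because the `(χ,U)`-eigenvector condition is MONOTONE in `U`.  Generic `𝒢`.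
-/
import Summits.HodgeConjecture.HodgeConjecture.Theorems.K2E1ResidualLevelFiniteOfAtomsU     -- ★ p860390 (K2E4-p14): `levelFinite_of_atoms`, `residual_admissible_of_atoms`, `residualSpectrumCompact_of_atoms`
import HarnessLib

/-!
# 5Res AMENDMENT #3, rung G0 — `K2E1ResidualLevelFiniteOfCofinalU`: ATOMS ON A COFINAL FAMILY OF LEVELS ⟹ ATOMS AT EVERY LEVEL ⟹ level-finiteness ∕ admissibility ∕ compactness of `L²_res`

Track B ∕ K2-LIT, crux h413 = `stmt-HodgeConjecture-24833`, route of record `HCCMUnconditional`; cell `hodgecm-mathlib`, squad K2, ENGINE E1 (5Res ∕ 12R3); dealer K2E1-plan (g7) rulings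
(266) (AMENDMENT #3 §0 «COFINALITY») and (268)(i).  THEOREMS ONLY (no `def`, no `instance`, no `notation`, no named-fact hypothesis, no `sorry`); lane
`--supports stmt-HodgeConjecture-24833 --as helper` (count-neutral).  Generic adelic datum `𝒢` (serves `U(1,1)` = 5Res and `U(2,1)` = 12R3 alike).
THE MATHEMATICS ([MoeglinWaldspurger1995, I.2.18]; [BorelJacquet1979, §4.6]).  The endgame binder of ★ p860390 is `hatoms : ∀ (χ : T →* ℂ) (U : OpenSubgroup K_f), ∃ P A, dim A < ∞ ∧
(P fixes every `x` with `R(u)x = x (u ∈ U)` and `R(t)x = χ(t)x`) ∧ (P maps every irreducible `W ≤ L²_res` into A)`.  The fixing clause is MONOTONE IN THE LEVEL: if `U′ ≤ U`, a vector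
fixed by `U` is fixed by `U′`, so an atom `(P, A)` for `(χ, U′)` IS an atom for `(χ, U)` (§1 `atoms_mono`).  Hence atoms on any family of levels `U_i` (`i` with `good i`) that is
COFINAL — every open `U` contains some good `U_i` — give atoms at every `(χ, U)` (§1 HEAD `atoms_of_cofinal`), and ★ p860390's three conclusions follow BY NAME (§2): the `hfin`
binder (every joint `(χ,U)`-eigenspace of `L²_res` finite-dimensional), `K`-admissibility of `L²_res`, and `ResidualSpectrumCompact 𝒢 μ 𝔓`.  For the CM pair the good levels are the
principal congruence subgroups `K_f(𝔫)` with `𝔫̄ = 𝔫` (the CM print `K2E1SelfConjugateLevelsCofinalCM` supplies `hcof`); this file is the generic half.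
* §1 `atoms_mono` (an atom for `(χ,U′)`, `U′ ≤ U`, is an atom for `(χ,U)`), HEAD **`atoms_of_cofinal`** (`hatoms` of ★ p860390 VERBATIM from atoms on a cofinal family).
* §2 BY NAME: **`levelFinite_of_cofinal_atoms`**, **`residual_admissible_of_cofinal_atoms`**, **`residualSpectrumCompact_of_cofinal_atoms`** (★ p860390's three heads ∘ §1).
HONEST LABEL: HC_CM is proved only modulo the 7 printed citations (2 remaining named inputs: hLiu418 = `stmt-HodgeConjecture-24832`, h413 = `stmt-HodgeConjecture-24833`) until rung 0
closes; this file asserts no named fact and closes no socket; count-neutral; CONDITIONAL on the atoms of the cofinal family (visible binder) — 5Res ∕ 12R3 stay OPEN until they are paid.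

## References
* [MoeglinWaldspurger1995] C. Mœglin, J.-L. Waldspurger, *Spectral decomposition and Eisenstein series* (1995), I.2.18, V.3.13.
* [BorelJacquet1979] A. Borel, H. Jacquet, *Automorphic forms and automorphic representations*, Corvallis I (1979), §4.6.
-/

set_option autoImplicit false
-- the mandated namespace repeats the single-problem summit's segment (`HodgeConjecture.HodgeConjecture`)
set_option linter.dupNamespace false

noncomputable section

open MeasureTheory Filter Topology Set
open Literature.NumberTheory.Automorphic ContRepresentation
open Summit.HodgeConjecture.HodgeConjecture.Cruxes.H413.K2E1CuspidalSpectrumUnitary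
open Summit.HodgeConjecture.HodgeConjecture.Cruxes.H413.K2E1ResidualLevelFiniteOfAtomsU (levelFinite_of_atoms residual_admissible_of_atoms residualSpectrumCompact_of_atoms)

namespace Summit.HodgeConjecture.HodgeConjecture.Cruxes.H413.K2E1ResidualLevelFiniteOfCofinalU

universe u

variable {F : Type} [Field F] [NumberField F] (𝒢 : AdelicGroupData.{u} F) (μ : Measure 𝒢.automorphicQuotient) [𝒢.IsAutomorphicMeasure μ]
  (𝔓 : 𝒢.ParabolicUnipotentData)

/-! ## §1 Atoms are monotone in the level; atoms on a cofinal family of levels are atoms everywhere -/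

/-- **AN ATOM FOR `(χ, U′)` IS AN ATOM FOR `(χ, U)` WHEN `U′ ≤ U`**: a vector fixed by `U` is fixed by `U′`, so the fixing clause of ★ `levelFinite_of_atoms` only gets weaker; the other two
clauses do not see the level. [cite: MoeglinWaldspurger1995, I.2.18] -/
theorem atoms_mono
    {K : Type*} [Group K] (ιK : K →* 𝒢.Adelic) {T : Type*} [Group T] (ιa : T →* K) {Kf : Type*} [Group Kf] [TopologicalSpace Kf] (ιf : Kf →* K)
    (χ : T →* ℂ) {U' U : OpenSubgroup Kf} (hU : U' ≤ U)
    (h : ∃ (P : 𝒢.L2 μ →L[ℂ] 𝒢.L2 μ) (A : Submodule ℂ (𝒢.L2 μ)), FiniteDimensional ℂ A ∧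
      (∀ x : 𝒢.L2 μ, (∀ u ∈ U', 𝒢.rightRegular μ (ιK (ιf u)) x = x) → (∀ t : T, 𝒢.rightRegular μ (ιK (ιa t)) x = χ t • x) → P x = x) ∧
      ∀ W : ClosedSubrep (𝒢.rightRegular μ), W.toContRep.IsTopIrreducible → W ≤ residualSubspace 𝒢 μ 𝔓 → ∀ w ∈ W, P w ∈ A) :
    ∃ (P : 𝒢.L2 μ →L[ℂ] 𝒢.L2 μ) (A : Submodule ℂ (𝒢.L2 μ)), FiniteDimensional ℂ A ∧
      (∀ x : 𝒢.L2 μ, (∀ u ∈ U, 𝒢.rightRegular μ (ιK (ιf u)) x = x) → (∀ t : T, 𝒢.rightRegular μ (ιK (ιa t)) x = χ t • x) → P x = x) ∧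
      ∀ W : ClosedSubrep (𝒢.rightRegular μ), W.toContRep.IsTopIrreducible → W ≤ residualSubspace 𝒢 μ 𝔓 → ∀ w ∈ W, P w ∈ A := by
  obtain ⟨P, A, hA, hfix, hW⟩ := h
  exact ⟨P, A, hA, fun x hxU hxT => hfix x (fun u hu => hxU u (hU hu)) hxT, hW⟩

/-- **HEAD — ATOMS ON A COFINAL FAMILY OF LEVELS ⟹ THE ATOMS BINDER OF ★ `levelFinite_of_atoms` VERBATIM.**  Data: a family of levels `𝒰 i : OpenSubgroup K_f` selected by a predicate
`good` (E1∕CM: `i = 𝔫` an ideal, `good 𝔫 := 𝔫̄ = 𝔫`, `𝒰 𝔫 = K_f(𝔫)`), COFINAL: every open `U` contains some good `𝒰 i` (`hcof`); atoms paid at every `(χ, 𝒰 i)`, `good i` (`hatoms𝒰`).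
CONCLUSION: `hatoms` at every `(χ, U)`. [cite: MoeglinWaldspurger1995, I.2.18] [cite: BorelJacquet1979, §4.6] -/
theorem atoms_of_cofinal
    {K : Type*} [Group K] (ιK : K →* 𝒢.Adelic) {T : Type*} [Group T] (ιa : T →* K) {Kf : Type*} [Group Kf] [TopologicalSpace Kf] (ιf : Kf →* K)
    {ι : Type*} (good : ι → Prop) (𝒰 : ι → OpenSubgroup Kf) (hcof : ∀ U : OpenSubgroup Kf, ∃ i, good i ∧ 𝒰 i ≤ U)
    (hatoms𝒰 : ∀ (χ : T →* ℂ) (i : ι), good i → ∃ (P : 𝒢.L2 μ →L[ℂ] 𝒢.L2 μ) (A : Submodule ℂ (𝒢.L2 μ)), FiniteDimensional ℂ A ∧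
      (∀ x : 𝒢.L2 μ, (∀ u ∈ 𝒰 i, 𝒢.rightRegular μ (ιK (ιf u)) x = x) → (∀ t : T, 𝒢.rightRegular μ (ιK (ιa t)) x = χ t • x) → P x = x) ∧
      ∀ W : ClosedSubrep (𝒢.rightRegular μ), W.toContRep.IsTopIrreducible → W ≤ residualSubspace 𝒢 μ 𝔓 → ∀ w ∈ W, P w ∈ A) :
    ∀ (χ : T →* ℂ) (U : OpenSubgroup Kf), ∃ (P : 𝒢.L2 μ →L[ℂ] 𝒢.L2 μ) (A : Submodule ℂ (𝒢.L2 μ)), FiniteDimensional ℂ A ∧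
      (∀ x : 𝒢.L2 μ, (∀ u ∈ U, 𝒢.rightRegular μ (ιK (ιf u)) x = x) → (∀ t : T, 𝒢.rightRegular μ (ιK (ιa t)) x = χ t • x) → P x = x) ∧
      ∀ W : ClosedSubrep (𝒢.rightRegular μ), W.toContRep.IsTopIrreducible → W ≤ residualSubspace 𝒢 μ 𝔓 → ∀ w ∈ W, P w ∈ A := by
  intro χ U
  obtain ⟨i, hi, hiU⟩ := hcof U
  exact atoms_mono 𝒢 μ 𝔓 ιK ιa ιf χ hiU (hatoms𝒰 χ i hi)

/-! ## §2 BY NAME: level-finiteness, admissibility and compactness of `L²_res` from atoms on a cofinal family -/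

/-- **COFINAL ATOMS ⟹ LEVEL-FINITENESS** (the `hfin` binder of ★ K2E4-p11's `finiteDimensional_homRangeSum_of_level_finite` VERBATIM): ★ `levelFinite_of_atoms` ∘ §1.
[cite: MoeglinWaldspurger1995, I.2.18 and V.3.13] -/
theorem levelFinite_of_cofinal_atoms
    {K : Type*} [Group K] (ιK : K →* 𝒢.Adelic) {T : Type*} [Group T] (ιa : T →* K) {Kf : Type*} [Group Kf] [TopologicalSpace Kf] (ιf : Kf →* K)
    {ι : Type*} (good : ι → Prop) (𝒰 : ι → OpenSubgroup Kf) (hcof : ∀ U : OpenSubgroup Kf, ∃ i, good i ∧ 𝒰 i ≤ U)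
    (hatoms𝒰 : ∀ (χ : T →* ℂ) (i : ι), good i → ∃ (P : 𝒢.L2 μ →L[ℂ] 𝒢.L2 μ) (A : Submodule ℂ (𝒢.L2 μ)), FiniteDimensional ℂ A ∧
      (∀ x : 𝒢.L2 μ, (∀ u ∈ 𝒰 i, 𝒢.rightRegular μ (ιK (ιf u)) x = x) → (∀ t : T, 𝒢.rightRegular μ (ιK (ιa t)) x = χ t • x) → P x = x) ∧
      ∀ W : ClosedSubrep (𝒢.rightRegular μ), W.toContRep.IsTopIrreducible → W ≤ residualSubspace 𝒢 μ 𝔓 → ∀ w ∈ W, P w ∈ A) :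
    ∀ (χ : T →* ℂ) (U : OpenSubgroup Kf),
      FiniteDimensional ℂ ↥((⨅ u : U, Module.End.eigenspace ((((residualSubspace 𝒢 μ 𝔓).toContRep.restrict ιK) (ιf (u : Kf))).toLinearMap) 1) ⊓
        ⨅ t : T, Module.End.eigenspace ((((residualSubspace 𝒢 μ 𝔓).toContRep.restrict ιK) (ιa t)).toLinearMap) (χ t)) :=
  levelFinite_of_atoms 𝒢 μ 𝔓 ιK ιa ιf (atoms_of_cofinal 𝒢 μ 𝔓 ιK ιa ιf good 𝒰 hcof hatoms𝒰)

/-- **COFINAL ATOMS ⟹ `L²_res` IS `K`-ADMISSIBLE** (the `hadm` binder of ★ `residualSpectrumCompact_of_admissible` VERBATIM): ★ `residual_admissible_of_atoms` ∘ §1.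
[cite: MoeglinWaldspurger1995, I.2.18 and V.3.13] -/
theorem residual_admissible_of_cofinal_atoms
    {K : Type*} [Group K] (ιK : K →* 𝒢.Adelic)
    {T : Type*} [Group T] (ιa : T →* K) (hιa : ∀ (t : T) (k : K), ιa t * k = k * ιa t)
    {Kf : Type*} [Group Kf] [TopologicalSpace Kf] [IsTopologicalGroup Kf] [CompactSpace Kf] [T2Space Kf] [TotallyDisconnectedSpace Kf] (ιf : Kf →* K)
    (hcont : ∀ v : (residualSubspace 𝒢 μ 𝔓).toSubmodule, Continuous fun k : Kf => ((residualSubspace 𝒢 μ 𝔓).toContRep.restrict ιK) (ιf k) v)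
    {ι : Type*} (good : ι → Prop) (𝒰 : ι → OpenSubgroup Kf) (hcof : ∀ U : OpenSubgroup Kf, ∃ i, good i ∧ 𝒰 i ≤ U)
    (hatoms𝒰 : ∀ (χ : T →* ℂ) (i : ι), good i → ∃ (P : 𝒢.L2 μ →L[ℂ] 𝒢.L2 μ) (A : Submodule ℂ (𝒢.L2 μ)), FiniteDimensional ℂ A ∧
      (∀ x : 𝒢.L2 μ, (∀ u ∈ 𝒰 i, 𝒢.rightRegular μ (ιK (ιf u)) x = x) → (∀ t : T, 𝒢.rightRegular μ (ιK (ιa t)) x = χ t • x) → P x = x) ∧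
      ∀ W : ClosedSubrep (𝒢.rightRegular μ), W.toContRep.IsTopIrreducible → W ≤ residualSubspace 𝒢 μ 𝔓 → ∀ w ∈ W, P w ∈ A) :
    ∀ (E : Submodule ℂ (residualSubspace 𝒢 μ 𝔓).toSubmodule)
      (hE : ∀ k, ∀ x ∈ E, ((residualSubspace 𝒢 μ 𝔓).toContRep.restrict ιK) k x ∈ E), FiniteDimensional ℂ E →
      (((residualSubspace 𝒢 μ 𝔓).toContRep.restrict ιK).subRep E hE).IsIrreducible →
      FiniteDimensional ℂ (Representation.homRangeSum ((residualSubspace 𝒢 μ 𝔓).toContRep.restrict ιK).toRepresentation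
        (((residualSubspace 𝒢 μ 𝔓).toContRep.restrict ιK).subRep E hE)) :=
  residual_admissible_of_atoms 𝒢 μ 𝔓 ιK ιa hιa ιf hcont (atoms_of_cofinal 𝒢 μ 𝔓 ιK ιa ιf good 𝒰 hcof hatoms𝒰)

/-- **COFINAL ATOMS ⟹ `ResidualSpectrumCompact 𝒢 μ 𝔓`**: ★ `residualSpectrumCompact_of_atoms` ∘ §1.  For `𝒢 = U(Φ_N)∕CM`, `good 𝔫 := 𝔫̄ = 𝔫`, `𝒰 𝔫 = K_f(𝔫)` this is 5Res (`N = 2`) ∕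
12R3 (`N = 3`) modulo the atoms at the self-conjugate levels (AMENDMENT #3, G11) and the CM cofinality print. [cite: MoeglinWaldspurger1995, I.2.18 and V.3.13] -/
theorem residualSpectrumCompact_of_cofinal_atoms [LocallyCompactSpace 𝒢.Adelic]
    {K : Type*} [Group K] [TopologicalSpace K] [IsTopologicalGroup K] [CompactSpace K] [T2Space K] (ιK : K →* 𝒢.Adelic) (hι : Continuous ιK)
    {T : Type*} [Group T] (ιa : T →* K) (hιa : ∀ (t : T) (k : K), ιa t * k = k * ιa t)
    {Kf : Type*} [Group Kf] [TopologicalSpace Kf] [IsTopologicalGroup Kf] [CompactSpace Kf] [T2Space Kf] [TotallyDisconnectedSpace Kf] (ιf : Kf →* K)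
    (hcont : ∀ v : (residualSubspace 𝒢 μ 𝔓).toSubmodule, Continuous fun k : Kf => ((residualSubspace 𝒢 μ 𝔓).toContRep.restrict ιK) (ιf k) v)
    {ι : Type*} (good : ι → Prop) (𝒰 : ι → OpenSubgroup Kf) (hcof : ∀ U : OpenSubgroup Kf, ∃ i, good i ∧ 𝒰 i ≤ U)
    (hatoms𝒰 : ∀ (χ : T →* ℂ) (i : ι), good i → ∃ (P : 𝒢.L2 μ →L[ℂ] 𝒢.L2 μ) (A : Submodule ℂ (𝒢.L2 μ)), FiniteDimensional ℂ A ∧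
      (∀ x : 𝒢.L2 μ, (∀ u ∈ 𝒰 i, 𝒢.rightRegular μ (ιK (ιf u)) x = x) → (∀ t : T, 𝒢.rightRegular μ (ιK (ιa t)) x = χ t • x) → P x = x) ∧
      ∀ W : ClosedSubrep (𝒢.rightRegular μ), W.toContRep.IsTopIrreducible → W ≤ residualSubspace 𝒢 μ 𝔓 → ∀ w ∈ W, P w ∈ A) :
    ResidualSpectrumCompact 𝒢 μ 𝔓 :=
  residualSpectrumCompact_of_atoms 𝒢 μ 𝔓 ιK hι ιa hιa ιf hcont (atoms_of_cofinal 𝒢 μ 𝔓 ιK ιa ιf good 𝒰 hcof hatoms𝒰)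

end Summit.HodgeConjecture.HodgeConjecture.Cruxes.H413.K2E1ResidualLevelFiniteOfCofinalU

end
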